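import Mathlib
import Literature.Probability.Percolation.PercolationProofs
import Literature.Probability.LatticeModels.ProdBernoulliIndependence
import Summits.CriticalPhenomena.PercolationContinuityZ3.Theorems.PercNearOneGluingAdditiveGluingOffObserverFibres
import Summits.CriticalPhenomena.PercolationContinuityZ3.Theorems.PercNearOneGluingAdditiveGluingSigmaRecursion
import Summits.CriticalPhenomena.PercolationContinuityZ3.Theorems.PercNearOneGluingAdditiveGluingBlockGrowth
import HarnessLib

/-! # Crux `PercNearOneGluing.AdditiveGluing` (stmt-CriticalPhenomena-4576), stub `stub_goodStep` — the pockets of a BLOCK observer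

Support file (stub-plan prover; towards the two-relay drift theorem = `stub_blockGoodTwo` at `A.card ≤ 3`, STUB-PLAN §4).
Lands `--supports stmt-CriticalPhenomena-4576`; no definitions, no named facts.

Notation: `μ = prodBernoulli u` on the bond configurations of `Fin n`; for a block `S` of vertices its cluster
`K_S(ω) = ⋃_{s ∈ S} C(s)`; the block POCKET event `{K_S = W} = {ω | ∀ z, z ∈ W ↔ ω ∈ ⋃_{s∈S} {s ↔ z}}` (the event of
`goodStep24_main`'s kernel `hker`).
* `blockPocket_eq_preimage`: `{K_S = W}` is the preimage of the point pocket `{C(s₀) = W}` (`s₀ ∈ S`) under gluing the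
  block (`ω ↦ ω ∪ D_S`, seat k46/`stub_glueReach`); hence it is determined by the pairs meeting `W`
  (`blockPocket_determinedBy`) and satisfies the **pocket Markov property** `μ({K_S = W} ∩ E) = μ(K_S = W) μ(E)` for
  events `E` determined by the pairs avoiding `W` (`blockPocket_markov`);
* `blockPocket_inter_openConn`, `blockPocket_mul_offConn`: on `{K_S = W}` a vertex `a ∉ W` reaches `b'` iff it does so
  avoiding `W`, so `μ(K_S = W) · μ(a ↔ b' in Wᶜ) = μ({K_S = W} ∩ {a ↔ b'})`;
* `blockPocket_sum_inter`: the fibre sum `Σ_{W ∩ A = ∅} μ({K_S = W} ∩ E) = μ(E ∩ {K_S ∩ A = ∅})`;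
* `blockGood_of_target_min`: the block-goodness inequality in the degenerate case where the designated relay is the
  target `b` itself (every relay is then almost surely joined to `b`).
[folklore; Grimmett 1999 §1.3; Kozma–Nitzan arXiv:2401.12397 §3.2 (proof of Thm 5, p. 14: Markov property of pockets)]
-/

namespace Summit.CriticalPhenomena.PercolationContinuityZ3.Theorems

open MeasureTheory Set
open Literature.Probability.LatticeModels (prodBernoulli)
open Literature.Probability.Percolation (BondConfig openConn openConnIn openGraph openCluster)
open scoped BigOperators

noncomputable section
open Classical

section BlockPockets

open Literature.Probability.LatticeModels Literature.Probability.Percolation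

variable {n : ℕ}

/-- The block pocket event is the preimage of a point pocket under gluing the block: for `s₀ ∈ S`,
`{K_S = W} = {ω | C_{ω ∪ D_S}(s₀) = W}`. [cite: KozmaNitzan2024, §3.1 (gluing, Remark p. 5)] -/
theorem blockPocket_eq_preimage (S W : Finset (Fin n)) (s₀ : Fin n) (hs₀ : s₀ ∈ S) :
    {ω : BondConfig (Fin n) | ∀ z : Fin n, (z ∈ W ↔ ω ∈ ⋃ s ∈ S, openConn s z)} =
      {ω : BondConfig (Fin n) |
        openCluster (ω ∪ {e | (∀ x ∈ e, x ∈ S) ∧ ¬ e.IsDiag}) s₀ = (W : Set (Fin n))} := by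
  have hglue : ∀ (ω : BondConfig (Fin n)) (z : Fin n),
      z ∈ openCluster (ω ∪ {e | (∀ x ∈ e, x ∈ S) ∧ ¬ e.IsDiag}) s₀ ↔ ω ∈ ⋃ s ∈ S, openConn s z := by
    intro ω z
    show (ω ∪ {e | (∀ x ∈ e, x ∈ S) ∧ ¬ e.IsDiag}) ∈ openConn s₀ z ↔ _
    rw [stub_glueReach n S ω s₀ z]
    simp only [Set.mem_iUnion, exists_prop]
    constructor
    · rintro (h' | ⟨-, s, hs, h'⟩)
      · exact ⟨s₀, hs₀, h'⟩
      · exact ⟨s, hs, h'⟩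
    · rintro ⟨s, hs, h'⟩
      exact Or.inr ⟨⟨s₀, hs₀, (SimpleGraph.Reachable.refl s₀ : (openGraph ω).Reachable s₀ s₀)⟩, s, hs, h'⟩
  ext ω
  simp only [Set.mem_setOf_eq]
  rw [Set.ext_iff]
  constructor
  · intro h z
    rw [hglue, Finset.mem_coe]
    exact (h z).symm
  · intro h z
    have hz := h z
    rw [hglue, Finset.mem_coe] at hz
    exact hz.symm

/-- A block pocket with `S ⊄ W` is empty. [folklore] -/
theorem blockPocket_eq_empty (S W : Finset (Fin n)) (s₀ : Fin n) (hs₀ : s₀ ∈ S) (hs₀W : s₀ ∉ W) :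
    {ω : BondConfig (Fin n) | ∀ z : Fin n, (z ∈ W ↔ ω ∈ ⋃ s ∈ S, openConn s z)} = ∅ := by
  ext ω
  simp only [Set.mem_setOf_eq, Set.mem_empty_iff_false, iff_false, not_forall]
  refine ⟨s₀, fun h => hs₀W (h.2 ?_)⟩
  exact Set.mem_iUnion₂.2 ⟨s₀, hs₀, (SimpleGraph.Reachable.refl s₀ : (openGraph ω).Reachable s₀ s₀)⟩

/-- **The block pocket `{K_S = W}` is determined by the pairs meeting `W`.** [cite: KozmaNitzan2024, §3.2 (proof of Thm 5, p. 14)] -/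
theorem blockPocket_determinedBy (S W : Finset (Fin n)) (hS : S.Nonempty) :
    DeterminedBy {ω : BondConfig (Fin n) | ∀ z : Fin n, (z ∈ W ↔ ω ∈ ⋃ s ∈ S, openConn s z)}
      (↑(Finset.univ.filter fun e : Sym2 (Fin n) => ∃ x ∈ W, x ∈ e) : Set (Sym2 (Fin n))) := by
  obtain ⟨s₀, hs₀⟩ := hS
  by_cases hs₀W : s₀ ∈ W
  · rw [blockPocket_eq_preimage S W s₀ hs₀, determinedBy_iff]
    intro ω ω' hag
    have key := (determinedBy_iff _ _).1 (goodPM_determinedBy_cluster_eq s₀ W hs₀W)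
      (ω ∪ {e | (∀ x ∈ e, x ∈ S) ∧ ¬ e.IsDiag}) (ω' ∪ {e | (∀ x ∈ e, x ∈ S) ∧ ¬ e.IsDiag}) (by
        rw [Set.union_inter_distrib_right, Set.union_inter_distrib_right, hag])
    exact key
  · rw [blockPocket_eq_empty S W s₀ hs₀ hs₀W, determinedBy_iff]
    intro ω ω' _
    simp

/-- **Pocket Markov property for a block**: for `S ≠ ∅` and an event `E` determined by the pairs avoiding `W`,
`μ({K_S = W} ∩ E) = μ(K_S = W) · μ(E)`. [cite: KozmaNitzan2024, §3.2 (proof of Thm 5, p. 14)] -/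
theorem blockPocket_markov (u : Sym2 (Fin n) → unitInterval) (S W : Finset (Fin n)) (hS : S.Nonempty)
    (E : Set (BondConfig (Fin n)))
    (hE : DeterminedBy E (↑(Finset.univ.filter fun e : Sym2 (Fin n) => ∀ v ∈ e, v ∉ W) : Set (Sym2 (Fin n)))) :
    (prodBernoulli u).real ({ω : BondConfig (Fin n) | ∀ z : Fin n, (z ∈ W ↔ ω ∈ ⋃ s ∈ S, openConn s z)} ∩ E) =
      (prodBernoulli u).real {ω : BondConfig (Fin n) | ∀ z : Fin n, (z ∈ W ↔ ω ∈ ⋃ s ∈ S, openConn s z)} *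
        (prodBernoulli u).real E := by
  refine prodBernoulli_real_inter_of_determinedBy_disjoint u
    (F := Finset.univ.filter fun e : Sym2 (Fin n) => ∃ x ∈ W, x ∈ e)
    (F' := Finset.univ.filter fun e : Sym2 (Fin n) => ∀ v ∈ e, v ∉ W) ?_
    (blockPocket_determinedBy S W hS) hE MeasurableSet.of_discrete MeasurableSet.of_discrete
  rw [Finset.disjoint_left]
  intro e he he'
  obtain ⟨x, hxW, hxe⟩ := (Finset.mem_filter.1 he).2
  exact (Finset.mem_filter.1 he').2 x hxe hxW

/-- On `{K_S = W}`, a vertex `a ∉ W` reaches `b'` iff it does so avoiding `W`. [folklore] -/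
theorem blockPocket_inter_openConn (S W : Finset (Fin n)) (a b' : Fin n) (haW : a ∉ W) :
    {ω : BondConfig (Fin n) | ∀ z : Fin n, (z ∈ W ↔ ω ∈ ⋃ s ∈ S, openConn s z)} ∩ openConn a b' =
      {ω : BondConfig (Fin n) | ∀ z : Fin n, (z ∈ W ↔ ω ∈ ⋃ s ∈ S, openConn s z)} ∩
        openConnIn ((W : Set (Fin n))ᶜ) a b' := by
  ext ω
  simp only [Set.mem_inter_iff, Set.mem_setOf_eq]
  refine ⟨fun h => ⟨h.1, ?_⟩, fun h => ⟨h.1, ?_⟩⟩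
  · obtain ⟨hW, hab⟩ := h
    have hout : ∀ y : Fin n, (openGraph ω).Reachable a y → y ∈ ((W : Set (Fin n))ᶜ : Set (Fin n)) := by
      intro y hy hyW
      obtain ⟨s, hs, hsy⟩ := Set.mem_iUnion₂.1 ((hW y).1 (Finset.mem_coe.1 hyW))
      have hsa : ω ∈ openConn s a := (show (openGraph ω).Reachable s y from hsy).trans hy.symm
      exact haW ((hW a).2 (Set.mem_iUnion₂.2 ⟨s, hs, hsa⟩))
    apply Literature.Probability.Percolation.DCT16.mem_openConnIn_of_pathIn
    have hr : (openGraph ω).Reachable a b' := hab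
    rw [SimpleGraph.reachable_iff_reflTransGen] at hr
    refine ⟨hout a (SimpleGraph.Reachable.refl a), ?_⟩
    clear hab
    induction hr with
    | refl => exact Relation.ReflTransGen.refl
    | @tail x y hax hxy ih =>
      exact ih.tail ⟨hxy, hout y ((SimpleGraph.reachable_iff_reflTransGen _ _).2 (hax.tail hxy))⟩
  · exact Literature.Probability.Percolation.DCT16.reachable_of_pathIn
      (Literature.Probability.Percolation.DCT16.pathIn_of_mem_openConnIn h.2)

/-- **Pocket Markov, two-point form**: for `S ≠ ∅` and `a ∉ W`,
`μ(K_S = W) · μ(a ↔ b' in Wᶜ) = μ({K_S = W} ∩ {a ↔ b'})`. [cite: KozmaNitzan2024, §3.2 (proof of Thm 5, p. 14)] -/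
theorem blockPocket_mul_offConn (u : Sym2 (Fin n) → unitInterval) (S W : Finset (Fin n)) (hS : S.Nonempty)
    (a b' : Fin n) (haW : a ∉ W) :
    (prodBernoulli u).real {ω : BondConfig (Fin n) | ∀ z : Fin n, (z ∈ W ↔ ω ∈ ⋃ s ∈ S, openConn s z)} *
        (prodBernoulli u).real (openConnIn ((W : Set (Fin n))ᶜ) a b') =
      (prodBernoulli u).real
        ({ω : BondConfig (Fin n) | ∀ z : Fin n, (z ∈ W ↔ ω ∈ ⋃ s ∈ S, openConn s z)} ∩ openConn a b') := by
  rw [blockPocket_inter_openConn S W a b' haW,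
    blockPocket_markov u S W hS _ (offObs_determinedBy_openConnIn_compl W a b')]

/-- **Fibre sum over the values of `K_S`**: for a predicate `P` on vertex sets,
`μ(E ∩ {P(K_S)}) = Σ_W 1{P W} μ({K_S = W} ∩ E)`. [folklore] -/
theorem blockPocket_real_eq_sum (u : Sym2 (Fin n) → unitInterval) (S : Finset (Fin n))
    (E : Set (BondConfig (Fin n))) (P : Finset (Fin n) → Prop) :
    (prodBernoulli u).real (E ∩ {ω | P (Finset.univ.filter fun z : Fin n => ω ∈ ⋃ s ∈ S, openConn s z)}) =
      ∑ W : Finset (Fin n), if P W then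
        (prodBernoulli u).real ({ω : BondConfig (Fin n) | ∀ z : Fin n, (z ∈ W ↔ ω ∈ ⋃ s ∈ S, openConn s z)} ∩ E)
        else 0 := by
  set f : BondConfig (Fin n) → Finset (Fin n) := fun ω => Finset.univ.filter fun z : Fin n => ω ∈ ⋃ s ∈ S, openConn s z
    with hf
  have hfib : ∀ W : Finset (Fin n),
      f ⁻¹' {W} = {ω : BondConfig (Fin n) | ∀ z : Fin n, (z ∈ W ↔ ω ∈ ⋃ s ∈ S, openConn s z)} := by
    intro W
    ext ω
    simp only [Set.mem_preimage, Set.mem_singleton_iff, Set.mem_setOf_eq, hf, Finset.ext_iff,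
      Finset.mem_filter, Finset.mem_univ, true_and]
    exact forall_congr' fun z => Iff.comm
  rw [← sigmaRec_sum_preimage_inter u f (E ∩ {ω | P (f ω)})]
  refine Finset.sum_congr rfl fun W _ => ?_
  by_cases hW : P W
  · rw [if_pos hW, hfib]
    congr 1
    ext ω
    simp only [Set.mem_inter_iff, Set.mem_setOf_eq]
    constructor
    · rintro ⟨hc, hωE, -⟩; exact ⟨hc, hωE⟩
    · rintro ⟨hc, hωE⟩
      refine ⟨hc, hωE, ?_⟩
      have : f ω = W := by
        have h' : ω ∈ f ⁻¹' {W} := by rw [hfib]; exact hc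
        simpa using h'
      rwa [this]
  · rw [if_neg hW]
    have : f ⁻¹' {W} ∩ (E ∩ {ω | P (f ω)}) = ∅ := by
      ext ω
      simp only [Set.mem_inter_iff, Set.mem_preimage, Set.mem_singleton_iff, Set.mem_setOf_eq,
        Set.mem_empty_iff_false, iff_false, not_and]
      intro hfW _ hP
      exact hW (hfW ▸ hP)
    rw [this, measureReal_empty]

/-- Fibre sum over the DEAD values of `K_S` (those avoiding `A`): `Σ_{W ∩ A = ∅} μ({K_S = W} ∩ E) = μ(E ∩ {K_S ∩ A = ∅})`,
with `K_S ∩ A = ∅` written as `∀ a ∈ A, S ↮ a`. [folklore] -/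
theorem blockPocket_sum_dead (u : Sym2 (Fin n) → unitInterval) (S A : Finset (Fin n))
    (E : Set (BondConfig (Fin n))) :
    ∑ W ∈ (Finset.univ : Finset (Finset (Fin n))).filter (fun W => Disjoint W A),
        (prodBernoulli u).real ({ω : BondConfig (Fin n) | ∀ z : Fin n, (z ∈ W ↔ ω ∈ ⋃ s ∈ S, openConn s z)} ∩ E) =
      (prodBernoulli u).real (E ∩ {ω | ∀ a ∈ A, ω ∉ ⋃ s ∈ S, openConn s a}) := by
  have h := blockPocket_real_eq_sum u S E (fun W => Disjoint W A)
  have hset : (E ∩ {ω : BondConfig (Fin n) | ∀ a ∈ A, ω ∉ ⋃ s ∈ S, openConn s a}) =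
      E ∩ {ω | Disjoint (Finset.univ.filter fun z : Fin n => ω ∈ ⋃ s ∈ S, openConn s z) A} := by
    ext ω
    simp only [Set.mem_inter_iff, Set.mem_setOf_eq, Finset.disjoint_left, Finset.mem_filter,
      Finset.mem_univ, true_and]
    exact and_congr_right fun _ => ⟨fun h' z hz hzA => h' z hzA hz, fun h' a haA ha => h' ha haA⟩
  rw [hset, h, Finset.sum_filter]
  refine Finset.sum_congr rfl fun W _ => ?_
  by_cases hW : Disjoint W A
  · rw [if_pos hW, if_pos hW]
  · rw [if_neg hW, if_neg hW]

/-- **Block goodness when the designated relay is the target.**  If `a₀ = b` minimises `μ(· ↔ b)` over `A` (so every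
relay is almost surely joined to `b`), then for every block `S ≠ ∅` and every selection
`sel W ∈ A`: `1 ≤ μ(S ↔ b) + Σ_{W ∩ A = ∅} μ(K_S = W) · μ(sel W ↔ b in Wᶜ)`. [cite: KozmaNitzan2024, §3.2 (Definition p. 12)] -/
theorem blockGood_of_target_min (u : Sym2 (Fin n) → unitInterval) (A S : Finset (Fin n)) (b : Fin n)
    (sel : Finset (Fin n) → Fin n) (hS : S.Nonempty)
    (hsel : ∀ W, sel W ∈ A)
    (hmin : ∀ a ∈ A, (prodBernoulli u).real (openConn b b) ≤ (prodBernoulli u).real (openConn a b)) :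
    (1 : ℝ) ≤ (prodBernoulli u).real (⋃ s ∈ S, openConn s b)
        + ∑ W ∈ (Finset.univ : Finset (Finset (Fin n))).filter (fun W => Disjoint W A),
            (prodBernoulli u).real {ω : BondConfig (Fin n) | ∀ z : Fin n, (z ∈ W ↔ ω ∈ ⋃ s ∈ S, openConn s z)}
              * (prodBernoulli u).real (openConnIn ((W : Set (Fin n))ᶜ) (sel W) b) := by
  set μ := prodBernoulli u with hμ
  have hbb : μ.real (openConn b b) = 1 := by
    have : (openConn b b : Set (BondConfig (Fin n))) = Set.univ :=
      Set.eq_univ_of_forall fun ω => (SimpleGraph.Reachable.refl b : (openGraph ω).Reachable b b)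
    rw [this, probReal_univ]
  -- every relay is a.s. joined to `b`
  have hfull : ∀ a ∈ A, μ.real (openConn a b)ᶜ = 0 := by
    intro a ha
    have h1 : μ.real (openConn a b) ≤ 1 := measureReal_le_one
    have h2 := hmin a ha
    rw [hbb] at h2
    have h3 := measureReal_add_measureReal_compl (μ := μ) (s := openConn a b) MeasurableSet.of_discrete
    rw [probReal_univ] at h3
    linarith
  -- each pocket term is at least `μ(K_S = W) - 0`
  have hterm : ∀ W ∈ (Finset.univ : Finset (Finset (Fin n))).filter (fun W => Disjoint W A),
      μ.real ({ω : BondConfig (Fin n) | ∀ z : Fin n, (z ∈ W ↔ ω ∈ ⋃ s ∈ S, openConn s z)} ∩ Set.univ) ≤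
      μ.real {ω : BondConfig (Fin n) | ∀ z : Fin n, (z ∈ W ↔ ω ∈ ⋃ s ∈ S, openConn s z)}
        * μ.real (openConnIn ((W : Set (Fin n))ᶜ) (sel W) b) := by
    intro W hW
    have hWA : Disjoint W A := (Finset.mem_filter.1 hW).2
    have hselW : sel W ∉ W := fun h => Finset.disjoint_left.1 hWA h (hsel W)
    rw [blockPocket_mul_offConn u S W hS (sel W) b hselW, Set.inter_univ]
    have e := measureReal_inter_add_sdiff₀ (μ := μ)
      (s := {ω : BondConfig (Fin n) | ∀ z : Fin n, (z ∈ W ↔ ω ∈ ⋃ s ∈ S, openConn s z)})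
      (t := openConn (sel W) b) MeasurableSet.of_discrete.nullMeasurableSet
    have e2 : μ.real ({ω : BondConfig (Fin n) | ∀ z : Fin n, (z ∈ W ↔ ω ∈ ⋃ s ∈ S, openConn s z)} \
        openConn (sel W) b) ≤ μ.real (openConn (sel W) b)ᶜ := measureReal_mono (Set.sdiff_subset_compl _ _)
    rw [hfull _ (hsel W)] at e2
    linarith [measureReal_nonneg (μ := μ)
      (s := {ω : BondConfig (Fin n) | ∀ z : Fin n, (z ∈ W ↔ ω ∈ ⋃ s ∈ S, openConn s z)} \ openConn (sel W) b)]
  refine le_trans ?_ (add_le_add le_rfl (Finset.sum_le_sum hterm))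
  rw [blockPocket_sum_dead u S A Set.univ, Set.univ_inter]
  -- `1 ≤ μ(S ↔ b) + μ(K_S ∩ A = ∅)`: the complement `{S ↮ b, K_S ∩ A ≠ ∅}` is null
  have hcov : μ.real ((⋃ s ∈ S, openConn s b) ∪ {ω | ∀ a ∈ A, ω ∉ ⋃ s ∈ S, openConn s a})ᶜ ≤
      ∑ a ∈ A, μ.real (openConn a b)ᶜ := by
    refine (measureReal_mono (fun ω hω => ?_) (measure_ne_top _ _)).trans
      (measureReal_biUnion_finset_le A fun a => (openConn a b)ᶜ)
    simp only [Set.mem_compl_iff, Set.mem_union, Set.mem_setOf_eq, not_or, not_forall, not_not] at hω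
    obtain ⟨hSb, a, ha, haK⟩ := hω
    refine Set.mem_iUnion₂.2 ⟨a, ha, fun hab => hSb ?_⟩
    obtain ⟨s, hs, hsa⟩ := Set.mem_iUnion₂.1 haK
    exact Set.mem_iUnion₂.2 ⟨s, hs, (show (openGraph ω).Reachable s a from hsa).trans hab⟩
  have hsum0 : ∑ a ∈ A, μ.real (openConn a b)ᶜ = 0 := Finset.sum_eq_zero hfull
  have hadd := measureReal_add_measureReal_compl (μ := μ)
    (s := (⋃ s ∈ S, openConn s b) ∪ {ω | ∀ a ∈ A, ω ∉ ⋃ s ∈ S, openConn s a}) MeasurableSet.of_discrete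
  rw [probReal_univ] at hadd
  have hun := measureReal_union_le (μ := μ) (⋃ s ∈ S, (openConn s b : Set (BondConfig (Fin n))))
    {ω | ∀ a ∈ A, ω ∉ ⋃ s ∈ S, openConn s a}
  linarith [measureReal_nonneg (μ := μ)
    (s := ((⋃ s ∈ S, openConn s b) ∪ {ω | ∀ a ∈ A, ω ∉ ⋃ s ∈ S, openConn s a})ᶜ)]

end BlockPockets

open Literature.Probability.LatticeModels Literature.Probability.Percolation in
/-- Registered helper stub `stub_blockPocketMarkov_sp` (stub-plan prover): the pocket Markov property of a BLOCK observer in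
two-point form, `μ(K_S = W) · μ(a ↔ b' in Wᶜ) = μ({K_S = W} ∩ {a ↔ b'})` for `S ≠ ∅`, `a ∉ W` (= `blockPocket_mul_offConn`).
[cite: KozmaNitzan2024, §3.2 (proof of Thm 5, p. 14)] -/
theorem stub_blockPocketMarkov_sp : ∀ (n : ℕ) (u : Sym2 (Fin n) → unitInterval) (S W : Finset (Fin n)), S.Nonempty → ∀ (a b' : Fin n), a ∉ W → (prodBernoulli u).real {ω : BondConfig (Fin n) | ∀ z : Fin n, (z ∈ W ↔ ω ∈ ⋃ s ∈ S, openConn s z)} * (prodBernoulli u).real (openConnIn ((W : Set (Fin n))ᶜ) a b') = (prodBernoulli u).real ({ω : BondConfig (Fin n) | ∀ z : Fin n, (z ∈ W ↔ ω ∈ ⋃ s ∈ S, openConn s z)} ∩ openConn a b') :=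
  fun _ u S W hS a b' haW => blockPocket_mul_offConn u S W hS a b' haW

end

end Summit.CriticalPhenomena.PercolationContinuityZ3.Theorems
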